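import Summits.MatrixMultiplication.MatrixMultiplication.Theorems.LevelGradedCohnUmansGradedDesignFamilyStubSubfieldCellTwentyfiveWitness

/-!
# Line form of the `|K| = 25` packaging lemma for subfield-cell certificates

Route `LevelGradedCohnUmans`, crux `GradedDesignFamily` (stmt-MatrixMultiplication-7610), line
`quadratic_extension_level_one_cell`, stub S3 `stub_subfieldCell`.  HONEST FRAMING: bookkeeping used by the
compiler-checked TRUE finite instances of the stub's inner clause at `q = 5`; it decides nothing about the
(asymptotic) stub and is NOT summit progress.

A level-one frame function `F(g) = ∑_u cf(u, g u)` whose `cf(·, v)` is supported on one representative `u_t` per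
line of `K²` is determined by the `26 × 624` table `R(t, v) = cf(u_t, v)`, and `F(g) = ∑_t R(t, g u_t)`.  The lemma
below restates `subfieldCell_twentyfive_pack` with the separation identities in this LINE FORM, so that a
certificate is checked with `26` table reads per point (`native_decide`) instead of a filter over all `625` vectors.
-/

namespace Summit.MatrixMultiplication.MatrixMultiplication.Theorems.GradedDesignFamily

open Matrix

/-- **Line form of the packaging lemma** `subfieldCell_twentyfive_pack` (`|K| = 25`): if the integer
frame table of target `j` is given per LINE REPRESENTATIVE — `R j t v` for `26` vectors `urep t ∈ K²`
(one per line of `K²`, or any `26` vectors at all) — and the separation identities hold in line form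
`∑_t R j t (X · urep t) = N_j · [g = 1 ∧ y_i = y_i' ∧ z_l = z_j]`, then the clause of `stub_subfieldCell`
holds with the frame function `cf u v = (∑_t [u = urep t] · R j t v) / N_j` (supported on the `urep t`).
The reduction is `Finset.sum_comm` + `Finset.sum_ite_eq'`; it lets the compiled check of a certificate
read `26` table rows per point instead of filtering all `625` vectors `u`.  (Bookkeeping for
certificates; not summit progress.) -/
theorem subfieldCell_twentyfive_pack_lines [hp : Fact (Nat.Prime 5)] [hF : Fact (∀ r : ZMod 5, r ^ 2 ≠ 2 + 0 * r)]
    [hK : Fintype (QuadraticAlgebra (ZMod 5) 2 0)] (h9 : Fintype.card (QuadraticAlgebra (ZMod 5) 2 0) = 25) {ny nz nt : ℕ}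
    (yOf : Fin ny → GL (Fin 2) (QuadraticAlgebra (ZMod 5) 2 0))
    (zOf : Fin nz → GL (Fin 2) (QuadraticAlgebra (ZMod 5) 2 0))
    (urep : Fin nt → Fin 2 → QuadraticAlgebra (ZMod 5) 2 0)
    (R : Fin nz → Fin nt → (Fin 2 → QuadraticAlgebra (ZMod 5) 2 0) → ℤ)
    (N : Fin nz → ℕ) (hy : Function.Injective yOf) (hz : Function.Injective zOf) (hN : ∀ j, 0 < N j)
    (key : ∀ j : Fin nz, ∀ g : Matrix.SpecialLinearGroup (Fin 2) (ZMod 5), ∀ i i' : Fin ny, ∀ l : Fin nz,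
      (let X : Matrix (Fin 2) (Fin 2) (QuadraticAlgebra (ZMod 5) 2 0) :=
          ((Matrix.SpecialLinearGroup.mapGL (QuadraticAlgebra (ZMod 5) 2 0) g * yOf i * (yOf i')⁻¹ * zOf l :
            GL (Fin 2) (QuadraticAlgebra (ZMod 5) 2 0)) : Matrix (Fin 2) (Fin 2) (QuadraticAlgebra (ZMod 5) 2 0))
        let x₀₀ : QuadraticAlgebra (ZMod 5) 2 0 := X 0 0
        let x₀₁ : QuadraticAlgebra (ZMod 5) 2 0 := X 0 1
        let x₁₀ : QuadraticAlgebra (ZMod 5) 2 0 := X 1 0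
        let x₁₁ : QuadraticAlgebra (ZMod 5) 2 0 := X 1 1
        ∑ t : Fin nt, R j t (!![x₀₀, x₀₁; x₁₀, x₁₁].mulVec (urep t))) =
        if g = 1 ∧ yOf i = yOf i' ∧ zOf l = zOf j then (N j : ℤ) else 0) :
    ∃ (k K : Type) (_ : Field k) (_ : Fintype k) (_ : DecidableEq k)
      (_ : Field K) (_ : Fintype K) (_ : DecidableEq K)
      (φ : Matrix.SpecialLinearGroup (Fin 2) k →* Matrix.GeneralLinearGroup (Fin 2) K),
      Function.Injective φ ∧ Fintype.card K = Fintype.card k ^ 2 ∧ Fintype.card K = 25 ∧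
      ∃ Y Z : Finset (Matrix.GeneralLinearGroup (Fin 2) K),
        Y.card = ny ∧ Z.card = nz ∧
        ∀ z₀ ∈ Z, ∃ cf : (Fin 2 → K) → (Fin 2 → K) → ℂ,
          ∀ a : Matrix.SpecialLinearGroup (Fin 2) k, ∀ y ∈ Y, ∀ y' ∈ Y, ∀ z ∈ Z,
            (∑ u : Fin 2 → K, cf u (((φ a * y * y'⁻¹ * z : Matrix.GeneralLinearGroup (Fin 2) K) :
                Matrix (Fin 2) (Fin 2) K).mulVec u)) =
              if a = 1 ∧ y = y' ∧ z = z₀ then 1 else 0 :=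
  subfieldCell_twentyfive_pack (hp := hp) (hF := hF) (hK := hK) h9 yOf zOf
    (fun j u v => ∑ t : Fin nt, if u = urep t then R j t v else 0) N hy hz hN (by
      intro j g i i' l
      have h1 := key j g i i' l
      dsimp only at h1 ⊢
      rw [Finset.sum_comm]
      simpa only [Finset.sum_ite_eq', Finset.sum_ite_eq, Finset.mem_univ, if_true] using h1)

end Summit.MatrixMultiplication.MatrixMultiplication.Theorems.GradedDesignFamily
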